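import Mathlib.Algebra.Lie.Extension
import Literature.Algebra.Lie.SurfaceLieAlgebra
import HarnessLib

/-!
# Derivations of the surface Lie algebra from generator data

Support file for item stmt-SmoothPoincare4-13527 (`LieGateIdentity`, route
`SmoothPoincare4/CongruenceShadows`, card artin-approximation-trisection-groups K1 (ii)+(iii)),
over the definitions of `Literature/Algebra/Lie/SurfaceLieAlgebra.lean` (`SurfaceLieAlgebra R g`,
`grade`, `derDegree`, `cutIdeal`, `cutStabilizerDegree`, `s4CutSystem`).

* `derivation_ext`, `exists_derivation`: a derivation of `𝔰_g(R)` is determined by its values on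
  the generators, and a family of values `v : Fin g × Bool → 𝔰_g(R)` extends to a derivation iff
  it kills the relation, `∑ᵢ (⁅aᵢ, v bᵢ⁆ - ⁅bᵢ, v aᵢ⁆) = 0` (= `D(∑ᵢ ⁅aᵢ, bᵢ⁆)` for the would-be
  `D`).  Existence: lift `x ↦ (gen x, v x)` to a Lie morphism from the free Lie algebra into the
  semidirect product `𝔰_g ⋉ 𝔰_g` (Mathlib's `LieAlgebra.ofTwoCocycle 0` on the adjoint module);
  its second component is a `proj`-derivation killing `ω`, hence descends to the quotient.
* the relation map `Φ(r) = ∑ᵢ (⁅aᵢ, r bᵢ⁆ - ⁅bᵢ, r aᵢ⁆)` on generator data `r` (written out in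
  full in the statements): linearity, `Φ` of the data of a derivation vanishes, `Φ` of a single
  datum, degree and cut-ideal bounds;
* `mem_derDegree_iff`: a derivation has degree `n` iff its generator values have bracket length
  `n + 1`; generator criteria for `cutStabilizerDegree`.

No new definitions, no named facts; everything over an arbitrary commutative ring `R`.
-/

-- the prescribed namespace `Summit.<P>.<Sub>.…` duplicates `SmoothPoincare4` (P = Sub)
set_option linter.dupNamespace false

open Literature.Algebra.Lie Literature.Algebra.Lie.SurfaceLieAlgebra
open LieModule.Cohomology

namespace Summit.SmoothPoincare4.SmoothPoincare4.Theorems.LieGateIdentity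

section Extend
variable {R : Type*} [CommRing R] {g : ℕ}

/-- Two derivations of `𝔰_g(R)` that agree on the generators are equal. [folklore] -/
theorem derivation_ext {D E : LieDerivation R (SurfaceLieAlgebra R g) (SurfaceLieAlgebra R g)}
    (h : ∀ x, D (gen R g x) = E (gen R g x)) : D = E :=
  LieDerivation.ext_of_lieSpan_eq_top (Set.range (gen R g)) (lieSpan_range_gen R g)
    (by rintro _ ⟨x, rfl⟩; exact h x)

/-- **Extension of generator data to a derivation.** If `v : Fin g × Bool → 𝔰_g(R)` satisfies
`∑ᵢ (⁅aᵢ, v bᵢ⁆ - ⁅bᵢ, v aᵢ⁆) = 0`, there is a derivation `D` of `𝔰_g(R)` with `D (gen x) = v x`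
for every letter `x`. [folklore] -/
theorem exists_derivation (v : Fin g × Bool → SurfaceLieAlgebra R g)
    (hv : ∑ i : Fin g, (⁅a R g i, v (i, true)⁆ - ⁅b R g i, v (i, false)⁆) = 0) :
    ∃ D : LieDerivation R (SurfaceLieAlgebra R g) (SurfaceLieAlgebra R g),
      ∀ x, D (gen R g x) = v x := by
  classical
  -- the semidirect product `𝔰_g ⋉ 𝔰_g` (adjoint module, zero cocycle)
  let c : twoCocycle R (SurfaceLieAlgebra R g) (SurfaceLieAlgebra R g) := 0
  let ψ : FreeLieAlgebra R (Fin g × Bool) →ₗ⁅R⁆ LieAlgebra.ofTwoCocycle c :=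
    FreeLieAlgebra.lift R fun x => LieAlgebra.ofProd c (gen R g x, v x)
  -- both components at once, as a linear map into the product
  let Ψ : FreeLieAlgebra R (Fin g × Bool) →ₗ[R] SurfaceLieAlgebra R g × SurfaceLieAlgebra R g :=
    { toFun := fun p => (LieAlgebra.ofProd c).symm (ψ p)
      map_add' := fun p q => by simp
      map_smul' := fun t p => by simp }
  have hΨ_of : ∀ x, Ψ (FreeLieAlgebra.of R x) = (gen R g x, v x) := fun x => by
    simp [Ψ, ψ, FreeLieAlgebra.lift_of_apply]
  have hΨ_lie : ∀ p q, Ψ ⁅p, q⁆ =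
      (⁅(Ψ p).1, (Ψ q).1⁆, ⁅(Ψ p).1, (Ψ q).2⁆ - ⁅(Ψ q).1, (Ψ p).2⁆) := fun p q => by
    change (LieAlgebra.ofProd c).symm (ψ ⁅p, q⁆) = _
    rw [LieHom.map_lie, LieAlgebra.bracket_ofTwoCocycle, Equiv.symm_apply_apply]
    simp [Ψ, c]
  -- first component is `proj`
  have hΨ_fst : ∀ p, (Ψ p).1 = proj R g p := by
    let π : LieAlgebra.ofTwoCocycle c →ₗ⁅R⁆ SurfaceLieAlgebra R g :=
      { toFun := fun e => ((LieAlgebra.ofProd c).symm e).1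
        map_add' := fun _ _ => by simp
        map_smul' := fun _ _ => by simp
        map_lie' := fun {_ _} => by simp [LieAlgebra.bracket_ofTwoCocycle] }
    have hπ : π.comp ψ = proj R g := FreeLieAlgebra.hom_ext fun x => by
      simp [π, ψ, FreeLieAlgebra.lift_of_apply]
    intro p
    exact LieHom.congr_fun hπ p
  -- `Ψ ω = 0`
  have hΨω : Ψ (surfaceOmega R g) = 0 := by
    simp only [surfaceOmega, map_sum, hΨ_lie, hΨ_of]
    rw [Prod.ext_iff, Prod.fst_sum, Prod.snd_sum]
    refine ⟨?_, ?_⟩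
    · simpa [a, b] using sum_lie_a_b R g
    · simpa [a, b] using hv
  -- hence `ψ` kills the ideal `(ω)`
  have hker : ∀ p ∈ surfaceOmegaIdeal R g, Ψ p = 0 := by
    have hle : surfaceOmegaIdeal R g ≤ ψ.ker := by
      change LieSubmodule.lieSpan R _ {surfaceOmega R g} ≤ ψ.ker
      rw [LieSubmodule.lieSpan_le, Set.singleton_subset_iff, SetLike.mem_coe, LieHom.mem_ker]
      have : ψ (surfaceOmega R g) = LieAlgebra.ofProd c (Ψ (surfaceOmega R g)) := by
        simp [Ψ]
      rw [this, hΨω]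
      rfl
    intro p hp
    have h0 : ψ p = 0 := LieHom.mem_ker.1 (hle hp)
    change (LieAlgebra.ofProd c).symm (ψ p) = 0
    rw [h0]
    rfl
  -- the second component descends to the quotient
  let d : FreeLieAlgebra R (Fin g × Bool) →ₗ[R] SurfaceLieAlgebra R g :=
    (LinearMap.snd R _ _).comp Ψ
  have hd : (surfaceOmegaIdeal R g).toSubmodule ≤ LinearMap.ker d := fun p hp => by
    change (Ψ p).2 = 0
    rw [hker p hp]
    rfl
  let D₀ : SurfaceLieAlgebra R g →ₗ[R] SurfaceLieAlgebra R g :=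
    (surfaceOmegaIdeal R g).toSubmodule.liftQ d hd
  have hD₀ : ∀ p, D₀ (proj R g p) = (Ψ p).2 := fun p =>
    Submodule.liftQ_apply _ _ p
  refine ⟨⟨D₀, ?_⟩, ?_⟩
  · intro x y
    obtain ⟨p, rfl⟩ := proj_surjective R g x
    obtain ⟨q, rfl⟩ := proj_surjective R g y
    rw [← LieHom.map_lie, hD₀, hD₀, hD₀, hΨ_lie, hΨ_fst, hΨ_fst]
  · intro x
    change D₀ (proj R g (FreeLieAlgebra.of R x)) = v x
    rw [hD₀, hΨ_of]

end Extend

section Data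

variable {R : Type*} [CommRing R] {g : ℕ}

-- The relation map on generator data is `Φ r = ∑ᵢ (⁅aᵢ, r bᵢ⁆ - ⁅bᵢ, r aᵢ⁆)`, the value on
-- `ω = ∑ᵢ ⁅aᵢ, bᵢ⁆` of the would-be derivation with generator values `r` (written out in full below).
/-- `Φ` is additive. [folklore] -/
theorem phi_add (r s : Fin g × Bool → SurfaceLieAlgebra R g) : (∑ i : Fin g, (⁅a R g i, (r + s) (i,
    true)⁆ - ⁅b R g i, (r + s) (i, false)⁆)) = (∑ i : Fin g, (⁅a R g i, r (i, true)⁆ - ⁅b R g i, r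
    (i, false)⁆)) + (∑ i : Fin g, (⁅a R g i, s (i, true)⁆ - ⁅b R g i, s (i, false)⁆)) := by
  simp only [Pi.add_apply, lie_add, ← Finset.sum_add_distrib]
  exact Finset.sum_congr rfl fun i _ => by abel

/-- `Φ` is homogeneous. [folklore] -/
theorem phi_smul (t : R) (r : Fin g × Bool → SurfaceLieAlgebra R g) : (∑ i : Fin g, (⁅a R g i, (t •
    r) (i, true)⁆ - ⁅b R g i, (t • r) (i, false)⁆)) = t • (∑ i : Fin g, (⁅a R g i, r (i, true)⁆ - ⁅b
    R g i, r (i, false)⁆)) := by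
  simp only [Pi.smul_apply, lie_smul, Finset.smul_sum, smul_sub]

/-- `Φ 0 = 0`. [folklore] -/
theorem phi_zero : (∑ i : Fin g, (⁅a R g i, ((0 : Fin g × Bool → SurfaceLieAlgebra R g)) (i, true)⁆
    - ⁅b R g i, ((0 : Fin g × Bool → SurfaceLieAlgebra R g)) (i, false)⁆)) = 0 := by
  simp

/-- `Φ (-r) = -Φ r`. [folklore] -/
theorem phi_neg (r : Fin g × Bool → SurfaceLieAlgebra R g) : (∑ i : Fin g, (⁅a R g i, (-r) (i,
    true)⁆ - ⁅b R g i, (-r) (i, false)⁆)) = -(∑ i : Fin g, (⁅a R g i, r (i, true)⁆ - ⁅b R g i, r (i,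
    false)⁆)) := by
  simp only [Pi.neg_apply, lie_neg, ← Finset.sum_neg_distrib]
  exact Finset.sum_congr rfl fun i _ => by abel

/-- `Φ (r - s) = Φ r - Φ s`. [folklore] -/
theorem phi_sub (r s : Fin g × Bool → SurfaceLieAlgebra R g) : (∑ i : Fin g, (⁅a R g i, (r - s) (i,
    true)⁆ - ⁅b R g i, (r - s) (i, false)⁆)) = (∑ i : Fin g, (⁅a R g i, r (i, true)⁆ - ⁅b R g i, r
    (i, false)⁆)) - (∑ i : Fin g, (⁅a R g i, s (i, true)⁆ - ⁅b R g i, s (i, false)⁆)) := by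
  rw [sub_eq_add_neg, phi_add, phi_neg, ← sub_eq_add_neg]

/-- The generator values of a derivation are killed by `Φ` (this is `D(∑ᵢ ⁅aᵢ, bᵢ⁆) = D 0`).
[folklore] -/
theorem phi_derivation (D : LieDerivation R (SurfaceLieAlgebra R g) (SurfaceLieAlgebra R g)) :
    (∑ i : Fin g, (⁅a R g i, (fun x => D (gen R g x)) (i, true)⁆ - ⁅b R g i, (fun x => D (gen R g
        x)) (i, false)⁆)) = 0 := by
  have h := congrArg D (sum_lie_a_b R g)
  rw [map_sum, map_zero] at h
  simpa only [LieDerivation.apply_lie_eq_sub, a, b] using h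

/-- `Φ` of a single datum at `bⱼ`. [folklore] -/
theorem phi_single_true (j : Fin g) (t : SurfaceLieAlgebra R g) :
    (∑ i : Fin g, (⁅a R g i, ((Pi.single (j, true) t : Fin g × Bool → SurfaceLieAlgebra R g)) (i,
        true)⁆ - ⁅b R g i, ((Pi.single (j, true) t : Fin g × Bool → SurfaceLieAlgebra R g)) (i,
        false)⁆)) = ⁅a R g j, t⁆ := by
  classical
  rw [Finset.sum_eq_single j]
  · simp
  · intro i _ hij
    simp [hij]
  · intro h; exact absurd (Finset.mem_univ j) h

/-- `Φ` of a single datum at `aⱼ`. [folklore] -/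
theorem phi_single_false (j : Fin g) (t : SurfaceLieAlgebra R g) :
    (∑ i : Fin g, (⁅a R g i, ((Pi.single (j, false) t : Fin g × Bool → SurfaceLieAlgebra R g)) (i,
        true)⁆ - ⁅b R g i, ((Pi.single (j, false) t : Fin g × Bool → SurfaceLieAlgebra R g)) (i,
        false)⁆)) = -⁅b R g j, t⁆ := by
  classical
  rw [Finset.sum_eq_single j]
  · simp
  · intro i _ hij
    simp [hij]
  · intro h; exact absurd (Finset.mem_univ j) h

/-- Data of degree `d + 1` have `Φ` of degree `d + 2`. [folklore] -/
theorem phi_mem_grade {d : ℕ} {r : Fin g × Bool → SurfaceLieAlgebra R g}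
    (hr : ∀ x, r x ∈ grade R g (d + 1)) : (∑ i : Fin g, (⁅a R g i, r (i, true)⁆ - ⁅b R g i, r (i,
        false)⁆)) ∈ grade R g (d + 2) := by
  have h12 : 1 + (d + 1) = d + 2 := by omega
  refine Submodule.sum_mem _ fun i _ => sub_mem ?_ ?_
  · rw [← h12]; exact lie_mem_grade R g (gen_mem_grade_one R g _) (hr _)
  · rw [← h12]; exact lie_mem_grade R g (gen_mem_grade_one R g _) (hr _)

/-- A cut system hitting every handle: if `r x ∈ I_S` for all `x ∈ S` then `Φ r ∈ I_S`
(each summand has a factor in `S` or a value in `I_S`). [folklore] -/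
theorem phi_mem_cutIdeal {S : Set (Fin g × Bool)}
    (hS : ∀ i : Fin g, (i, false) ∈ S ∨ (i, true) ∈ S) {r : Fin g × Bool → SurfaceLieAlgebra R g}
    (hr : ∀ x ∈ S, r x ∈ cutIdeal R g S) : (∑ i : Fin g, (⁅a R g i, r (i, true)⁆ - ⁅b R g i, r (i,
        false)⁆)) ∈ cutIdeal R g S := by
  refine Submodule.sum_mem _ fun i _ => sub_mem ?_ ?_
  · rcases hS i with h | h
    · exact lie_mem_left R _ (cutIdeal R g S) _ _ (gen_mem_cutIdeal R g h)
    · exact lie_mem_right R _ (cutIdeal R g S) _ _ (hr _ h)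
  · rcases hS i with h | h
    · exact lie_mem_right R _ (cutIdeal R g S) _ _ (hr _ h)
    · exact lie_mem_left R _ (cutIdeal R g S) _ _ (gen_mem_cutIdeal R g h)

/-- **Degree on generators.** A derivation has degree `n` iff it sends every generator into
bracket length `n + 1`. [folklore] -/
theorem mem_derDegree_iff {n : ℕ}
    {D : LieDerivation R (SurfaceLieAlgebra R g) (SurfaceLieAlgebra R g)} :
    D ∈ derDegree R g n ↔ ∀ x, D (gen R g x) ∈ grade R g (n + 1) := by
  constructor
  · intro h x
    rw [Nat.add_comm]
    exact h 1 (gen R g x) (gen_mem_grade_one R g x)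
  · intro h
    have key : ∀ w : FreeMagma (Fin g × Bool),
        D (bracketWord (gen R g) w) ∈ grade R g (w.length + n) := by
      intro w
      induction w using FreeMagma.recOnMul with
      | ih1 x => simpa only [bracketWord_of, FreeMagma.length, Nat.add_comm 1 n] using h x
      | ih2 u v hu hv =>
        rw [bracketWord_mul, LieDerivation.apply_lie_eq_sub]
        have e₁ : u.length + (v.length + n) = (u * v).length + n := by
          change _ = u.length + v.length + n; omega
        have e₂ : v.length + (u.length + n) = (u * v).length + n := by
          change _ = u.length + v.length + n; omega
        refine sub_mem ?_ ?_
        · rw [← e₁]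
          exact lie_mem_grade R g (bracketWord_mem_wordGrade (gen R g) u) hv
        · rw [← e₂]
          exact lie_mem_grade R g (bracketWord_mem_wordGrade (gen R g) v) hu
    intro i u hu
    refine Submodule.span_induction ?_ ?_ ?_ ?_ hu
    · rintro _ ⟨w, hw, rfl⟩
      have := key w
      rwa [show w.length = i from hw] at this
    · simp
    · intro x y _ _ hx hy; rw [map_add]; exact add_mem hx hy
    · intro t x _ hx; rw [map_smul]; exact Submodule.smul_mem _ t hx

/-- The generator values of a degree-`n` derivation have bracket length `n + 1`. [folklore] -/
theorem apply_gen_mem_grade {n : ℕ} {S : Set (Fin g × Bool)}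
    {D : LieDerivation R (SurfaceLieAlgebra R g) (SurfaceLieAlgebra R g)}
    (hD : D ∈ cutStabilizerDegree R g S n) (x : Fin g × Bool) :
    D (gen R g x) ∈ grade R g (n + 1) :=
  mem_derDegree_iff.1 ((mem_cutStabilizerDegree_iff R g).1 hD).2 x

/-- A derivation stabilising `I_S` sends the letters of `S` into `I_S`. [folklore] -/
theorem apply_gen_mem_cutIdeal {n : ℕ} {S : Set (Fin g × Bool)}
    {D : LieDerivation R (SurfaceLieAlgebra R g) (SurfaceLieAlgebra R g)}
    (hD : D ∈ cutStabilizerDegree R g S n) {x : Fin g × Bool} (hx : x ∈ S) :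
    D (gen R g x) ∈ cutIdeal R g S :=
  (mem_derStabilizer_cutIdeal_iff R g).1 ((mem_cutStabilizerDegree_iff R g).1 hD).1 x hx

/-- Conversely, generator conditions give membership in `Stab(I_S) ∩ Der_n`. [folklore] -/
theorem mem_cutStabilizerDegree_of_gen {n : ℕ} {S : Set (Fin g × Bool)}
    {D : LieDerivation R (SurfaceLieAlgebra R g) (SurfaceLieAlgebra R g)}
    (h₁ : ∀ x ∈ S, D (gen R g x) ∈ cutIdeal R g S) (h₂ : ∀ x, D (gen R g x) ∈ grade R g (n + 1)) :
    D ∈ cutStabilizerDegree R g S n :=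
  (mem_cutStabilizerDegree_iff R g).2
    ⟨(mem_derStabilizer_cutIdeal_iff R g).2 h₁, mem_derDegree_iff.2 h₂⟩

end Data

end Summit.SmoothPoincare4.SmoothPoincare4.Theorems.LieGateIdentity
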